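/-
Copyright (c) 2026. Released under the Apache 2.0 license.
NS-CLAIMS SWEEP (D-0090) — C149 `PereiraSilva2025` (T3 QUICK, RULINGS v1.35 (7)). SKELETON (conv. (a)).
-/
import Literature.Claims.NS.ClayVariants
import Literature.Claims.NS.ClayR3EnstrophyBridge
import Literature.Claims.NS.ClayR3HorizonBridge
import Literature.Claims.NS.PaiLimsuwan2026
import HarnessLib

/-!
# Claim skeleton C149 — F. R. Pereira Silva, «Smoothness of Navier-Stokes Solutions in Three
# Dimensions» (Zenodo record 15214381 = v1 of concept 15214380, created 2025-04-14, printed date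
# «March 30, 2025»; 6 pp., English; PDF page = printed page)

UNREFEREED CLAIM under adjudication (cell `ns-claims`, D-0090) — NOTHING HERE ASSERTS A STEP: every
printed assertion is a `def … : Prop`; the only `theorem`s are kernel-checked relations between them and
theorems of the tree. Typist of record ns-claims-typist-8 g6. Text of record: the census pin
`census/texts/PereiraSilva2025/` (PDF sha16 57231ced7d5b10c1; lit lane `sources/PereiraSilva2025/`,
LOCATORS.md by ns-claims-lit-2 g5; line numbers below = lines of `pages/pNNN.txt`, displays of p.3 read
on the render). The text has NO Theorem/Lemma environment: the claim is carried by the abstract p.1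
l.5–11, §1 p.1 l.28–30 and §4 p.5 l.36–42; the proof is §3.1–§3.6 (p.2–5). Later versions v2/v3 of the
concept and the same creator's record 15283554 (which claims finite-time singularities for the same
equations) are lineage only (CARD §1).

CLAIMED STATEMENT (abstract p.1 l.6–11; §1 p.1 l.28–30 «This work resolves alternative (A) of the CMI by
proving that smooth solutions exist globally and are unique»; §4 p.5 l.37–41; setting §1–§2 p.1: (1)
`∂ₜu + (u·∇)u = −∇p + ν∇²u`, (2) `∇·u = 0` on `ℝ³`, `ν > 0`, «no external forces», datum
`u₀ ∈ C^∞(ℝ³) ∩ 𝒮(ℝ³)`, `∇·u₀ = 0`): for every `ν > 0` and every such datum there is a solution with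
`u, p ∈ C^∞(ℝ³ × [0,∞))` (§3.6 p.5 l.19, §3.5 p.4 l.81–82), unique (§3.6 p.5 l.20–35: «for `w = u − v`
with `w(0) ≡ 0` … `w = 0`», an `L²`-argument — typed as uniqueness among finite-energy classical
solutions from the same datum on every slab). Direction: REGULARITY.

CLAY DELTA (reference `ClayVariants.lean`, (A) = `clayR3.Regularity`): Δ1 domain `ℝ³` «=»; Δ2/Δ3
equations (1)–(2), `ν > 0`, force ≡ 0 «=»; Δ4 data `C^∞ ∩ 𝒮(ℝ³)`, div-free = Schwartz = Clay (4) token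
for token «=» (LOCATORS §2); Δ5 conclusion: `u, p` smooth on the CLOSED half-space «=» (6), but NO
bounded-energy clause (7) in the claimed sentence (§3.1 proves `E(t) ≤ E(0)` inside the proof) — so
`clay_of_claimed : ClaimedTheorem → clayR3.Regularity` is NOT provable verbatim (one missing clause, as
C93/C136) and is not drafted; the printed ROUTE, however, goes through the uniform enstrophy bound
«`S(t) ≤ S(0)` for all `t ≥ 0`» (§3.3 p.4 l.22–28 = §4 p.5 l.40), which IS (A) by the tree's
`ClayVariants.clayR3_regularity_iff_aprioriEnstrophyBound` — `clay_of_steps` below is PROVED with no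
delta; Δ6 parameters: the constants `C_G`, `C` (p.3), `C'_G := C_G·2^{1/6}·C^{1/3}` (p.3 l.70–73) and the
«Poincaré constant `C_P` on `ℝ³`» (p.2 l.29–34, «will be explicitly computed» — no computation of `C_P`
appears in the 6 pp.) are typed as ONE parameter `K : Consts` of the steps (the C102 `N` / C133 `B`
shape: a kill is `∀ K, ¬ Step… K` or at an instance); the two printed provisos «assuming
`ν > (1/3)C_G²C'_G E(0)^{1/6}`» (p.3 l.167) and «Assuming `νC_P` dominates (which holds for typical
physical parameters), `k₁ − k₂ < 0`» (p.3 l.251–252, p.4 l.12) are INSIDE the proof while the claim is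
«for all positive viscosity» and every datum (abstract p.1 l.10–11) — typed as what the unconditional
conclusion needs (Δ7).

STEPS (print order; `S(t) = ∫|ω(t)|²` is the paper's enstrophy, p.2 l.7–14 and l.114–117 «since
`∇·u = 0`, `S(t) = ∫|ω|²`»; `E(t) = ½∫|u|²`):
* `Step2_GN K` — §2 p.2 l.24–28 «the Gagliardo–Nirenberg constant `C_G > 0` (e.g.
  `‖u‖_{L³} ≤ C_G‖u‖_{L²}^{2/3}‖∇u‖_{L²}^{1/3}`)», POSITED for use (used at p.3 l.45–47 with `u ← ω`, at
  p.4 l.52–56 with `u ← u(t)`). Functions grain. Typist's flag: inhomogeneous under the dilation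
  `f ↦ f(λ·)` on `ℝ³` (degrees `λ⁻¹` vs `λ^{−7/6}`; the 3-D exponents are `½, ½`) — kernel-decidable.
* `Step2_Poincare K` — §2 p.2 l.29–34 «the Poincaré constant `C_P > 0` (e.g. `‖∇ω‖²_{L²} ≥ C_P‖ω‖²_{L²}`)»,
  POSITED on the whole space (used at p.3 l.165). Functions grain over vorticities of Schwartz
  divergence-free fields. Typist's flag: no Poincaré inequality holds on `ℝ³` (dilation: `λ` vs `λ⁻¹`)
  — kernel-decidable; its solution-grain use is `Step32_PoincareSol K`.
* `Step31_Energy` — §3.1 p.2 l.101–112 «`E(t) = E(0) − ν∫₀ᵗS ≤ E(0)`», consumed p.3 l.48 as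
  «`‖u‖²_{L²} ≤ 2E(0)`». Solutions grain. True by literature (energy identity).
* `Step32_Identity` — §3.2 p.2 l.119–136, p.3 l.1–31 (advection term `= 0`), l.133–142 (viscous term):
  `½ dS/dt = ∫ω·((ω·∇)u) − ν‖∇ω‖²`. Solutions grain, interior times. True by literature.
* `Step32_Holder` — p.3 l.32–44 «`|∫ω·((ω·∇)u)| ≤ ‖ω‖_{L³}‖ω‖_{L³}‖∇u‖_{L³}`». Functions grain. True.
* `Step32_GNgrad K` — p.3 l.48 «`‖∇u‖_{L³} ≤ C_G‖u‖_{L²}^{1/3}‖∇²u‖_{L²}^{2/3}`». Functions grain. Flag: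
  dilation degrees `λ⁰` vs `λ^{−1/6}` — kernel-decidable.
* `Step32_Hess K` — p.3 l.48–50 «`‖∇²u‖²_{L²} ≤ C‖∇ω‖²_{L²}`» (div-free). Functions grain. True by
  literature (div–curl).
* `Step32_GradL3 K` — p.3 l.52–73 «`‖∇u‖_{L³} ≤ C_G(2E(0))^{1/6}(C‖∇ω‖²)^{1/3} = C'_GE(0)^{1/6}‖∇ω‖^{2/3}`»
  (the three previous displays combined along the solution). Solutions grain.
* `Step32_Young` — p.3 l.95–111 «`S^{2/3}‖∇ω‖^{4/3} ≤ (2/3)S + (1/3)‖∇ω‖²`», at the REAL grain at which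
  it is invoked («Apply Young's inequality to …»). Typist's flag: with the printed exponents Young gives
  `(1/3)‖∇ω‖⁴`, not `‖∇ω‖²`; as printed the display fails at `S = ‖∇ω‖ = 3` (`9 ≤ 5`) —
  kernel-decidable by `norm_num`-grade arithmetic.
* `Step32_StretchBound K` — p.3 l.113–132 «`∫ω·((ω·∇)u) ≤ (2/3)C_G²C'_GE(0)^{1/6}S +
  (1/3)C_G²C'_GE(0)^{1/6}‖∇ω‖²`». Solutions grain (printed support: Hölder, GN, GNgrad, Hess, Energy,
  Young). Flag: amplitude degrees 3 vs ≤ 7/3.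
* `Step32_Combine K` — p.3 l.143–147 «Combining: `dS/dt ≤ (2/3)C_G²C'_GE(0)^{1/6}S +
  ((1/3)C_G²C'_GE(0)^{1/6} − ν)‖∇ω‖²`» — AS PRINTED (the factor 2 of `½dS/dt` in `Step32_Identity` is
  dropped by the print, LOCATORS §4; recorded, not corrected). Solutions grain.
* `Step32_PoincareSol K` — p.3 l.165 «Using Poincaré's inequality, `‖∇ω‖² ≥ C_P S`» along the solution.
* `Step32_Proviso K` — p.3 l.167 «assuming `ν > (1/3)C_G²C'_GE(0)^{1/6}`» — needed for EVERY `ν > 0` and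
  every datum by the unconditional claim; typed at the DATA grain (`E(0) = ½∫|u₀|²`). Flag: amplitude
  `u₀ ↦ A·u₀` sends `E(0)^{1/6} ↦ A^{1/3}E(0)^{1/6}` — kernel-decidable for every `K`.
* `Step33_LinearIneq K` — p.3 l.197–222 = §3.3 p.4 l.3–10 «`dS/dt ≤ (k₁ − k₂)S`», `k₁ = (2/3)C_G²C'_GE(0)^{1/6}`,
  `k₂ = νC_P − (1/3)C_G²C'_GE(0)^{1/6}C_P`. Solutions grain. PROVED from Combine + PoincareSol + Proviso
  (`linearIneq_of_steps`, pure real algebra as printed p.3 l.165–176).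
* `Step33_Sign K` — p.3 l.251–252 «Assuming `νC_P` dominates (which holds for typical physical
  parameters), `k₁ − k₂ < 0`» = p.4 l.12 «Assuming `k₁ − k₂ < 0`» — for EVERY `ν > 0` and every datum
  (what §3.3–§4 use unconditionally: p.4 l.15 «Since `k₁ − k₂ < 0`», §4 p.5 l.40). DATA grain. Flag:
  `k₁ − k₂ = C_G²C'_GE(0)^{1/6}(2/3 + C_P/3) − νC_P` is positive for `E(0)` large — kernel-decidable.
  THE CARD-PREDICTED neighbourhood (§3.3); the census-read locator is `Step33_Uniform`.
* `Step32_Cont` — implicit in «the solution is `S(t) ≤ S(0)e^{(k₁−k₂)t}`» (p.4 l.12–14): `S` is continuous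
  on `[0,T)` (what Grönwall from `t = 0` presupposes). True by literature.
* `Step33_Gronwall` — p.4 l.12–14, the Grönwall step at the REAL grain: a continuous `S` on `[0,T)` with
  `S' ≤ kS` on `(0,T)` has `S(t) ≤ S(0)e^{kt}`. True (classical).
* `Step33_Uniform` — §3.3 p.4 l.15–28 «Since `k₁ − k₂ < 0`, `S(t) ≤ S(0)` … for all `t ≥ 0`» (= §4 p.5
  l.40 «The uniform bound on the enstrophy, `S(t) ≤ S(0)`, excludes all blow-ups») — for every
  solution of the class, every `ν > 0`. PROVED from LinearIneq + Sign + Identity + Cont + Gronwall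
  (`uniform_of_steps`). By itself: an a priori enstrophy bound = (A)-strength.
* §3.4 p.4 l.33–62 (exclusion of blow-ups: «`∫₀ᵀS ≤ E(0)/ν`», «`∫_{B(x₀,r)}|ω|² ≤ S(t) ≤ S(0)`», the `L³`
  remark), §3.5 p.4 l.63–82 (pressure by the Poisson equation), §3.6 p.5 l.1–35 (higher norms
  «`d/dt‖Dᵐu‖² ≤ CS(t)‖Dᵐu‖²`», uniqueness «`d/dt‖w‖² ≤ CS(t)‖w‖²`, `‖w(t)‖² ≤ 0`») = the passage «uniform
  enstrophy bound on every slab ⇒ global smooth solution, unique»: in the kernel this is a THEOREM of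
  the tree (`clayR3_regularity_iff_aprioriEnstrophyBound`: Leray 1934 §20/§33, Constantin–Fefferman
  1993; uniqueness `eqOn_Ico_of_claySolution`: Tao 2013 Cor. 11.4), used inside `claim_of_steps` — no
  Step fact (lit-4 g5 rule). Records-grade note: the printed `Hᵐ` and uniqueness Grönwall weights
  `C·S(t)` are not the classical ones (`‖∇u‖_∞`-type); these displays lie AFTER the locator region and
  are not typed.
* Appendix A p.6 (toroidal-vortex datum, «`S(t) ≤ S(0)`, confirming that no blow-ups occur for this
  initial data»): an APPLICATION of §3.3 to one datum; not typed (LOCATORS §1 row p.6 records the `1/r`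
  factor of the printed field at the axis).

COMPOSITION (PROVED, every binder USED): `linearIneq_of_steps : Step32_Combine K → Step32_PoincareSol K →
Step32_Proviso K → Step33_LinearIneq K`; `uniform_of_steps : Step33_LinearIneq K → Step33_Sign K →
Step32_Identity → Step32_Cont → Step33_Gronwall → Step33_Uniform`; `clay_of_uniform : Step33_Uniform →
clayR3.Regularity` (tree bridge); `claim_of_uniform : Step33_Uniform → ClaimedTheorem` (bridge + Tao
uniqueness); `claim_of_steps (K) : Step32_Combine K → Step32_PoincareSol K → Step32_Proviso K →
Step33_Sign K → Step32_Identity → Step32_Cont → Step33_Gronwall → ClaimedTheorem`. The functions-grain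
displays `Step2_GN`, `Step2_Poincare`, `Step32_Holder`, `Step32_GNgrad`, `Step32_Hess`, `Step32_Young` and
the solution-grain `Step31_Energy`, `Step32_GradL3`, `Step32_StretchBound` are the printed derivation of
`Step32_Combine` (p.3 l.32–147) and are recorded, each decidable alone; `Step2_Poincare K` is the §2 face
of the binder `Step32_PoincareSol K` (same constant; the binder is its use along solutions) — Appendix
(rev 2, append-only): `poincare_of_poincareSol : Step32_PoincareSol K → Step2_Poincare K` (the `t = 0`
link through `exists_slabSol`, so `¬ Step2_Poincare K` kills the binder: `not_poincareSol_of_not_poincare`),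
and the kernel certificates `step31_Energy_holds`, `step33_Gronwall_holds`.

WHAT THIS IS NOT: not a claim about NS regularity or blow-up; not a claim about any author beyond the
typed locator.
-/

open scoped ContDiff ENNReal Topology
open Set MeasureTheory Filter

namespace Literature.Claims.NS.PereiraSilva2025

open Literature.Analysis Literature.Analysis.FluidPDE Literature.Claims.NS.ClayVariants
open Literature.Claims.NS.PaiLimsuwan2026 (E3 SlabSol)

noncomputable section

/-! ## The functionals of §2 p.1–2 (tree vocabulary; `ω = ∇ × v` is `curl v`) -/

/-- `E = ½∫|v|²` of a field (p.2 l.1–6; `E(0) = ½∫|u₀|²`). [cite: PereiraSilva2025, §2 p.2 l.1–6] -/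
def En₀ (v : E3 → E3) : ℝ := (1 / 2) * ∫ x, ‖v x‖ ^ 2

/-- `‖f‖²_{L²} = ∫|f|²`. [cite: PereiraSilva2025, §2 p.2] -/
def l2sq (f : E3 → E3) : ℝ := ∫ x, ‖f x‖ ^ 2

/-- `‖∇f‖²_{L²} = ∫ Σⱼ|∂ⱼf|²` (the Frobenius norm of the gradient, as in `S(t) = ∫|∇u|²`, p.2 l.7–10).
[cite: PereiraSilva2025, §2 p.2 l.7–10] -/
def gradsqF (f : E3 → E3) : ℝ := ∫ x, ∑ j : Fin 3, ‖fderiv ℝ f x (EuclideanSpace.single j 1)‖ ^ 2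

/-- `‖f‖_{L³} = (∫|f|³)^{1/3}`. [cite: PereiraSilva2025, §2 p.2 l.24–28] -/
def l3 (f : E3 → E3) : ℝ := (∫ x, ‖f x‖ ^ 3) ^ (1 / 3 : ℝ)

/-- `‖∇f‖_{L³}` (operator norm of the Fréchet derivative; constants absorb the choice).
[cite: PereiraSilva2025, p.3 l.32–44] -/
def gradL3 (f : E3 → E3) : ℝ := (∫ x, ‖fderiv ℝ f x‖ ^ 3) ^ (1 / 3 : ℝ)

/-- `‖∇²f‖²_{L²}` (norm of the second Fréchet derivative). [cite: PereiraSilva2025, p.3 l.48–50] -/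
def hessL2sq (f : E3 → E3) : ℝ := ∫ x, ‖iteratedFDeriv ℝ 2 f x‖ ^ 2

/-- The vortex-stretching integral `∫ ω·((ω·∇)v) dx = ∫ ωᵢ ωⱼ ∂ⱼvᵢ dx` of a field `v`, `ω = ∇ × v`
(p.3 l.26–31). [cite: PereiraSilva2025, §3.2 p.3 l.26–31] -/
def stretchP (v : E3 → E3) : ℝ := ∫ x, inner ℝ (curl v x) (fderiv ℝ v x (curl v x))

/-- The enstrophy `S(t) = ∫|ω(t)|²` along a time-dependent field (p.2 l.7–14, l.114–117 «Since
`∇·u = 0`, `S(t) = ∫|ω|²dx`»). [cite: PereiraSilva2025, §2 p.2 l.7–14; §3.2 p.2 l.114–117] -/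
def Ens (u : ℝ → E3 → E3) (t : ℝ) : ℝ := ∫ x, ‖curl (u t) x‖ ^ 2

/-- `‖∇ω(t)‖²_{L²}` along a time-dependent field (p.3 l.133–142 «`−ν∫|∇ω|²`»).
[cite: PereiraSilva2025, §3.2 p.3 l.133–142] -/
def G (u : ℝ → E3 → E3) (t : ℝ) : ℝ := gradsqF (curl (u t))

/-! ## The constants (p.2 l.24–34, p.3 l.48–73) as ONE parameter -/

/-- The paper's constants: `C_G` (Gagliardo–Nirenberg, p.2 l.24), `C` (p.3 l.50 `‖∇²u‖² ≤ C‖∇ω‖²`),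
`C_P` («Poincaré constant», p.2 l.29), all `> 0` as printed. [cite: PereiraSilva2025, §2 p.2 l.24–34; p.3 l.48–50] -/
structure Consts where
  /-- `C_G > 0` (p.2 l.24). -/
  CG : ℝ
  /-- `C` of `‖∇²u‖² ≤ C‖∇ω‖²` (p.3 l.50). -/
  C : ℝ
  /-- `C_P > 0` (p.2 l.29). -/
  CP : ℝ
  CG_pos : 0 < CG
  C_pos : 0 < C
  CP_pos : 0 < CP

/-- `C'_G := C_G·2^{1/6}·C^{1/3}` (p.3 l.70–73: «`C_G(2E(0))^{1/6}(C‖∇ω‖²)^{1/3} = C'_GE(0)^{1/6}‖∇ω‖^{2/3}`»).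
[cite: PereiraSilva2025, p.3 l.70–73] -/
def Consts.CG' (K : Consts) : ℝ := K.CG * (2 : ℝ) ^ (1 / 6 : ℝ) * K.C ^ (1 / 3 : ℝ)

/-- `k₁ = (2/3)C_G²C'_GE(0)^{1/6}` (p.3 l.197–213, p.4 l.7–10). [cite: PereiraSilva2025, p.3 l.197–213] -/
def k1 (K : Consts) (E0 : ℝ) : ℝ := (2 / 3) * K.CG ^ 2 * K.CG' * E0 ^ (1 / 6 : ℝ)

/-- `k₂ = νC_P − (1/3)C_G²C'_GE(0)^{1/6}C_P` (p.3 l.197–213, p.4 l.7–10). [cite: PereiraSilva2025, p.3 l.197–213] -/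
def k2 (K : Consts) (ν E0 : ℝ) : ℝ := ν * K.CP - (1 / 3) * K.CG ^ 2 * K.CG' * E0 ^ (1 / 6 : ℝ) * K.CP

/-! ## The claimed statement -/

/-- **Abstract p.1 l.6–11 / §1 p.1 l.28–30 / §4 p.5 l.37–41** in the paper's setting ((1)–(2) on `ℝ³`,
`ν > 0`, no force, Schwartz divergence-free datum): there are `u, p ∈ C^∞(ℝ³ × [0,∞))` solving the
system from `u₀` (§3.6 p.5 l.19, §3.5 p.4 l.82), and the solution is unique (§3.6 p.5 l.20–35, an
`L²` energy argument on `w = u − v`: typed as agreement with every finite-energy classical solution from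
`u₀` on every slab `[0,T)`). No bounded-energy clause is part of the claimed sentence (Δ5).
[cite: PereiraSilva2025, abstract p.1 l.6–11; §1 p.1 l.28–30; §4 p.5 l.37–41] [claim: PereiraSilva2025, status: under-review] -/
def ClaimedTheorem : Prop :=
  ∀ ν : ℝ, 0 < ν → ∀ u₀ : E3 → E3, ContDiff ℝ ∞ u₀ → NSWave0.IsDivFree u₀ → HasRapidSpatialDecay u₀ →
    ∃ (u : ℝ → E3 → E3) (p : ℝ → E3 → ℝ),
      IsClassicalNSSolutionOn (Ici 0) ν 0 u p ∧ u 0 = u₀ ∧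
      IsSmoothOnHalfSpace u ∧ IsSmoothOnHalfSpace p ∧
      ∀ (T : ℝ) (v : ℝ → E3 → E3) (q : ℝ → E3 → ℝ),
        IsClassicalNSSolutionOn (Ico 0 T) ν 0 v q → v 0 = u₀ →
        (∃ A : ℝ≥0∞, A < ⊤ ∧ ∀ t ∈ Ico 0 T, ∫⁻ x, ‖v t x‖ₑ ^ 2 ≤ A) →
          ∀ t ∈ Ico 0 T, v t = u t

/-! ## The steps (print order)

Solutions grain = along every finite-energy classical solution of (1)–(2) with no force on a half-open
slab `[0,T) × ℝ³` from a Schwartz divergence-free datum, `ν > 0` (`PaiLimsuwan2026.SlabSol`, REUSED —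
token for token the class of the tree's enstrophy bridge, so that «for all `t ≥ 0` … no blow-up in
finite time» (p.4 l.28–32) has its meaning: a bound holding up to every candidate blow-up time `T`).
Inequality steps are stated on `[0,T)` (the datum slice `t = 0` included, as «for all `t`» reads);
derivative statements at interior times. -/

/-- **Step 2-GN — §2 p.2 l.24–28**, POSITED: «We use the Gagliardo-Nirenberg constant `C_G > 0` (e.g.,
`‖u‖_{L³} ≤ C_G‖u‖_{L²}^{2/3}‖∇u‖_{L²}^{1/3}`)», for smooth rapidly decaying fields on `ℝ³` (used with
`u ← ω` p.3 l.45–47, `u ← u(t)` p.4 l.52–56); `‖f‖_{L²}^{2/3} = (∫|f|²)^{1/3}`, `‖∇f‖_{L²}^{1/3} =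
(∫|∇f|²)^{1/6}`. Typist's flag: scaling-inhomogeneous on `ℝ³` — kernel-decidable.
[cite: PereiraSilva2025, §2 p.2 l.24–28] -/
def Step2_GN (K : Consts) : Prop :=
  ∀ f : E3 → E3, ContDiff ℝ ∞ f → HasRapidSpatialDecay f →
    l3 f ≤ K.CG * l2sq f ^ (1 / 3 : ℝ) * gradsqF f ^ (1 / 6 : ℝ)

/-- **Step 2-P — §2 p.2 l.29–34**, POSITED: «the Poincaré constant `C_P > 0` (e.g., `‖∇ω‖²_{L²} ≥
C_P‖ω‖²_{L²}`), which will be explicitly computed in our estimates» — on the whole space, for the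
vorticity `ω = ∇ × v` of smooth divergence-free rapidly decaying fields (no computation of `C_P` appears
in the text). Typist's flag: kernel-decidable (dilation). [cite: PereiraSilva2025, §2 p.2 l.29–34] -/
def Step2_Poincare (K : Consts) : Prop :=
  ∀ v : E3 → E3, ContDiff ℝ ∞ v → NSWave0.IsDivFree v → HasRapidSpatialDecay v →
    K.CP * l2sq (curl v) ≤ gradsqF (curl v)

/-- **Step 3.1 — §3.1 p.2 l.101–112** «`dE/dt = −νS(t)`, `E(t) = E(0) − ν∫₀ᵗS(τ)dτ ≤ E(0)`, implying
`‖u(t)‖²_{L²} = 2E(t) ≤ 2E(0)`» — the consumed face (p.3 l.48 «`‖u‖²_{L²} ≤ 2E(0)`»): along every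
solution of the class, `E(t) ≤ E(0)` on `[0,T)`. True by literature (energy identity).
[cite: PereiraSilva2025, §3.1 p.2 l.101–112] -/
def Step31_Energy : Prop :=
  ∀ (ν T : ℝ) (u₀ : E3 → E3) (u : ℝ → E3 → E3) (p : ℝ → E3 → ℝ), SlabSol ν T u₀ u p →
    ∀ t ∈ Ico 0 T, En₀ (u t) ≤ En₀ (u 0)

/-- **Step 3.2-identity — §3.2 p.2 l.119–136 with p.3 l.1–31, l.133–142**: multiplying the vorticity
equation by `ω` and integrating, advection term `= 0`, viscous term `= −ν∫|∇ω|²`: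
`½ d/dt ∫|ω|² = ∫ω·((ω·∇)u) − ν‖∇ω‖²_{L²}` along the solution, interior times. True by literature.
[cite: PereiraSilva2025, §3.2 p.2 l.119–136, p.3 l.1–31, l.133–142] -/
def Step32_Identity : Prop :=
  ∀ (ν T : ℝ) (u₀ : E3 → E3) (u : ℝ → E3 → E3) (p : ℝ → E3 → ℝ), SlabSol ν T u₀ u p →
    ∀ t ∈ Ioo 0 T, HasDerivAt (fun s => (1 / 2) * Ens u s) (stretchP (u t) - ν * G u t) t

/-- **Step 3.2-Hölder — p.3 l.32–44** «`|∫ω·((ω·∇)u)dx| ≤ ‖ω‖_{L³}‖ω‖_{L³}‖∇u‖_{L³}`», functions grain.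
True (Hölder `1/3 + 1/3 + 1/3`). [cite: PereiraSilva2025, p.3 l.32–44] -/
def Step32_Holder : Prop :=
  ∀ v : E3 → E3, ContDiff ℝ ∞ v → HasRapidSpatialDecay v →
    |stretchP v| ≤ l3 (curl v) * l3 (curl v) * gradL3 v

/-- **Step 3.2-GN′ — p.3 l.48 (first display)** «`‖∇u‖_{L³} ≤ C_G‖u‖_{L²}^{1/3}‖∇²u‖_{L²}^{2/3}`»,
functions grain; `‖u‖_{L²}^{1/3} = (∫|u|²)^{1/6}`, `‖∇²u‖_{L²}^{2/3} = (∫|∇²u|²)^{1/3}`. Typist's flag: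
scaling-inhomogeneous (degrees `λ⁰` vs `λ^{−1/6}`) — kernel-decidable. [cite: PereiraSilva2025, p.3 l.48] -/
def Step32_GNgrad (K : Consts) : Prop :=
  ∀ v : E3 → E3, ContDiff ℝ ∞ v → HasRapidSpatialDecay v →
    gradL3 v ≤ K.CG * l2sq v ^ (1 / 6 : ℝ) * hessL2sq v ^ (1 / 3 : ℝ)

/-- **Step 3.2-C — p.3 l.48–50 (third display)** «`‖∇²u‖²_{L²} ≤ C‖∇ω‖²_{L²}`» for divergence-free
fields. True by literature (div–curl / Calderón–Zygmund on `L²`). [cite: PereiraSilva2025, p.3 l.48–50] -/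
def Step32_Hess (K : Consts) : Prop :=
  ∀ v : E3 → E3, ContDiff ℝ ∞ v → NSWave0.IsDivFree v → HasRapidSpatialDecay v →
    hessL2sq v ≤ K.C * gradsqF (curl v)

/-- **Step 3.2-∇L³ — p.3 l.52–73** «`‖∇u‖_{L³} ≤ C_G(2E(0))^{1/6}(C‖∇ω‖²_{L²})^{1/3} =
C'_GE(0)^{1/6}‖∇ω‖_{L²}^{2/3}`» along the solution (GN′ + `‖u‖² ≤ 2E(0)` + C). Solutions grain.
[cite: PereiraSilva2025, p.3 l.52–73] -/
def Step32_GradL3 (K : Consts) : Prop :=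
  ∀ (ν T : ℝ) (u₀ : E3 → E3) (u : ℝ → E3 → E3) (p : ℝ → E3 → ℝ), SlabSol ν T u₀ u p →
    ∀ t ∈ Ico 0 T, gradL3 (u t) ≤ K.CG' * En₀ (u 0) ^ (1 / 6 : ℝ) * G u t ^ (1 / 3 : ℝ)

/-- **Step 3.2-Young — p.3 l.95–111** «Apply Young's inequality to `S^{2/3}‖∇ω‖_{L²}^{4/3}`:
`S^{2/3}‖∇ω‖^{4/3}_{L²} ≤ (2/3)S + (1/3)‖∇ω‖²_{L²}`», at the REAL grain at which it is invoked (`S ≥ 0`,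
`X = ‖∇ω‖_{L²} ≥ 0`). Typist's flag: the conjugate exponents `3/2, 3` give `(1/3)X⁴`, not `(1/3)X²`;
as printed the display fails at `S = X = 3` (`9 ≤ 5`). Kernel-decidable. [cite: PereiraSilva2025, p.3 l.95–111] -/
def Step32_Young : Prop :=
  ∀ S X : ℝ, 0 ≤ S → 0 ≤ X →
    S ^ (2 / 3 : ℝ) * X ^ (4 / 3 : ℝ) ≤ (2 / 3) * S + (1 / 3) * X ^ 2

/-- **Step 3.2-stretch — p.3 l.113–132** «so: `∫ω·((ω·∇)u)dx ≤ (2/3)C_G²C'_GE(0)^{1/6}S +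
(1/3)C_G²C'_GE(0)^{1/6}‖∇ω‖²_{L²}`» along the solution (printed support: Hölder, GN, GN′, C, §3.1,
Young). Solutions grain, `[0,T)`. Flag: amplitude degrees 3 vs ≤ 7/3. [cite: PereiraSilva2025, p.3 l.113–132] -/
def Step32_StretchBound (K : Consts) : Prop :=
  ∀ (ν T : ℝ) (u₀ : E3 → E3) (u : ℝ → E3 → E3) (p : ℝ → E3 → ℝ), SlabSol ν T u₀ u p →
    ∀ t ∈ Ico 0 T,
      stretchP (u t) ≤ (2 / 3) * K.CG ^ 2 * K.CG' * En₀ (u 0) ^ (1 / 6 : ℝ) * Ens u t +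
        (1 / 3) * K.CG ^ 2 * K.CG' * En₀ (u 0) ^ (1 / 6 : ℝ) * G u t

/-- **Step 3.2-combine — p.3 l.143–147, AS PRINTED** «Combining: `dS/dt ≤ (2/3)C_G²C'_GE(0)^{1/6}S +
((1/3)C_G²C'_GE(0)^{1/6} − ν)‖∇ω‖²_{L²}`» along the solution, at every interior time where `S` has a
derivative `D` (the print carries the stretching bound without the factor `2` of `Step32_Identity`'s
`½ d/dt` — LOCATORS §4; recorded as printed). [cite: PereiraSilva2025, p.3 l.143–147] -/
def Step32_Combine (K : Consts) : Prop :=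
  ∀ (ν T : ℝ) (u₀ : E3 → E3) (u : ℝ → E3 → E3) (p : ℝ → E3 → ℝ), SlabSol ν T u₀ u p →
    ∀ t ∈ Ioo 0 T, ∀ D : ℝ, HasDerivAt (Ens u) D t →
      D ≤ (2 / 3) * K.CG ^ 2 * K.CG' * En₀ (u 0) ^ (1 / 6 : ℝ) * Ens u t +
        ((1 / 3) * K.CG ^ 2 * K.CG' * En₀ (u 0) ^ (1 / 6 : ℝ) - ν) * G u t

/-- **Step 3.2-Poincaré (use) — p.3 l.165** «Using Poincaré's inequality, `‖∇ω‖²_{L²} ≥ C_P S`» along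
the solution, `[0,T)` (the solution-grain use of `Step2_Poincare K`, same constant).
[cite: PereiraSilva2025, p.3 l.165] -/
def Step32_PoincareSol (K : Consts) : Prop :=
  ∀ (ν T : ℝ) (u₀ : E3 → E3) (u : ℝ → E3 → E3) (p : ℝ → E3 → ℝ), SlabSol ν T u₀ u p →
    ∀ t ∈ Ico 0 T, K.CP * Ens u t ≤ G u t

/-- **Step 3.2-proviso — p.3 l.167** «and assuming `ν > (1/3)C_G²C'_GE(0)^{1/6}`, the coefficient of
`‖∇ω‖²` is negative» — needed by the unconditional claim for EVERY `ν > 0` and EVERY Schwartz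
divergence-free datum (`E(0) = ½∫|u₀|²`); DATA grain. Typist's flag: amplitude scaling of the datum —
kernel-decidable for every `K`. [cite: PereiraSilva2025, p.3 l.167] -/
def Step32_Proviso (K : Consts) : Prop :=
  ∀ ν : ℝ, 0 < ν → ∀ u₀ : E3 → E3, ContDiff ℝ ∞ u₀ → NSWave0.IsDivFree u₀ → HasRapidSpatialDecay u₀ →
    (1 / 3) * K.CG ^ 2 * K.CG' * En₀ u₀ ^ (1 / 6 : ℝ) < ν

/-- **Step 3.3-linear — p.3 l.197–222 = §3.3 p.4 l.3–10** «`dS/dt ≤ (k₁ − k₂)S`» with the printed `k₁`,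
`k₂`, along the solution at every interior time where `S` has a derivative `D`.
[cite: PereiraSilva2025, p.3 l.197–222; §3.3 p.4 l.3–10] -/
def Step33_LinearIneq (K : Consts) : Prop :=
  ∀ (ν T : ℝ) (u₀ : E3 → E3) (u : ℝ → E3 → E3) (p : ℝ → E3 → ℝ), SlabSol ν T u₀ u p →
    ∀ t ∈ Ioo 0 T, ∀ D : ℝ, HasDerivAt (Ens u) D t →
      D ≤ (k1 K (En₀ (u 0)) - k2 K ν (En₀ (u 0))) * Ens u t

/-- **Step 3.3-sign — p.3 l.251–252** «Assuming `νC_P` dominates (which holds for typical physical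
parameters), `k₁ − k₂ < 0`, ensuring decay of `S(t)`» = p.4 l.12 «Assuming `k₁ − k₂ < 0`», used
unconditionally from p.4 l.15 on («Since `k₁ − k₂ < 0`») and in §4 for every datum and every `ν > 0`;
DATA grain (`k₁`, `k₂` depend on `ν`, the constants and `E(0) = ½∫|u₀|²` only). Typist's flag:
`k₁ − k₂ = C_G²C'_GE(0)^{1/6}(2/3 + C_P/3) − νC_P > 0` once `E(0)` is large — kernel-decidable for every
`K`. [cite: PereiraSilva2025, p.3 l.251–252; §3.3 p.4 l.12] -/
def Step33_Sign (K : Consts) : Prop :=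
  ∀ ν : ℝ, 0 < ν → ∀ u₀ : E3 → E3, ContDiff ℝ ∞ u₀ → NSWave0.IsDivFree u₀ → HasRapidSpatialDecay u₀ →
    k1 K (En₀ u₀) - k2 K ν (En₀ u₀) < 0

/-- **Step 3.2-cont (implicit, p.4 l.12–14)** — what «the solution is `S(t) ≤ S(0)e^{(k₁−k₂)t}`» presupposes
of `S`: `t ↦ S(t)` is continuous on `[0,T)` along the solution. True by literature.
[cite: PereiraSilva2025, §3.3 p.4 l.12–14] -/
def Step32_Cont : Prop :=
  ∀ (ν T : ℝ) (u₀ : E3 → E3) (u : ℝ → E3 → E3) (p : ℝ → E3 → ℝ), SlabSol ν T u₀ u p →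
    ContinuousOn (Ens u) (Ico 0 T)

/-- **Step 3.3-Grönwall — p.4 l.12–14** «the solution is: `S(t) ≤ S(0)e^{(k₁−k₂)t}`», at the REAL grain:
a function continuous on `[0,T)`, differentiable on `(0,T)` with `S' ≤ kS` there, satisfies
`S(t) ≤ S(0)e^{kt}` on `[0,T)`. True (Grönwall). [cite: PereiraSilva2025, §3.3 p.4 l.12–14] -/
def Step33_Gronwall : Prop :=
  ∀ (T k : ℝ) (S : ℝ → ℝ), ContinuousOn S (Ico 0 T) →
    (∀ t ∈ Ioo 0 T, ∃ D : ℝ, HasDerivAt S D t ∧ D ≤ k * S t) →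
      ∀ t ∈ Ico 0 T, S t ≤ S 0 * Real.exp (k * t)

/-- **Step 3.3-uniform — §3.3 p.4 l.15–28** «Since `k₁ − k₂ < 0`, `S(t) ≤ S(0)`, and thus: `S(t) ≤ S(0)`,
for all `t ≥ 0`. Therefore `∫₀ᵀS(t)dt ≤ S(0)T < ∞` for any finite `T`, ensuring no blow-up in finite
time» (= §4 p.5 l.40 «The uniform bound on the enstrophy, `S(t) ≤ S(0)`, excludes all blow-ups»): along
EVERY solution of the class, every `ν > 0`, `S(t) ≤ S(0)` on `[0,T)`. The census-read locator. An a
priori enstrophy bound — (A)-strength by the tree bridge (`clay_of_uniform`).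
[cite: PereiraSilva2025, §3.3 p.4 l.15–28; §4 p.5 l.40] -/
def Step33_Uniform : Prop :=
  ∀ (ν T : ℝ) (u₀ : E3 → E3) (u : ℝ → E3 → E3) (p : ℝ → E3 → ℝ), SlabSol ν T u₀ u p →
    ∀ t ∈ Ico 0 T, Ens u t ≤ Ens u 0

/-! ## Composition (PROVED) -/

/-- **p.3 l.165–176 ⊢ p.3 l.214–222 (PROVED, pure real algebra as printed)**: from «Combining», the
Poincaré use `‖∇ω‖² ≥ C_PS` and the proviso `ν > (1/3)C_G²C'_GE(0)^{1/6}` (so the coefficient of `‖∇ω‖²`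
is negative and may be replaced by its value on `C_PS`): `dS/dt ≤ (k₁ − k₂)S`.
[cite: PereiraSilva2025, p.3 l.165–222] -/
theorem linearIneq_of_steps (K : Consts) (hC : Step32_Combine K) (hP : Step32_PoincareSol K)
    (hν : Step32_Proviso K) : Step33_LinearIneq K := by
  intro ν T u₀ u p hS t ht D hD
  have h1 := hC ν T u₀ u p hS t ht D hD
  have h2 := hP ν T u₀ u p hS t (Ioo_subset_Ico_self ht)
  have h3 := hν ν hS.visc u₀ hS.data_smooth hS.data_divFree hS.data_decay
  rw [← hS.initial] at h3
  set A : ℝ := K.CG ^ 2 * K.CG' * En₀ (u 0) ^ (1 / 6 : ℝ) with hA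
  have h1' : D ≤ (2 / 3) * A * Ens u t + ((1 / 3) * A - ν) * G u t := by
    simpa only [hA, mul_assoc] using h1
  have h3' : (1 / 3) * A < ν := by simpa only [hA, mul_assoc] using h3
  have h4 : ((1 / 3) * A - ν) * G u t ≤ ((1 / 3) * A - ν) * (K.CP * Ens u t) :=
    mul_le_mul_of_nonpos_left h2 (by linarith)
  have hk : k1 K (En₀ (u 0)) - k2 K ν (En₀ (u 0)) = (2 / 3) * A + ((1 / 3) * A - ν) * K.CP := by
    simp only [k1, k2, hA]; ring
  rw [hk]
  nlinarith [h1', h4]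

/-- **§3.3 p.4 l.3–28 (PROVED)**: the linear inequality, the assumed sign, the differentiability of `S`
(from the enstrophy identity), its continuity on `[0,T)` and Grönwall give `S(t) ≤ S(0)e^{(k₁−k₂)t} ≤ S(0)`
on every slab. [cite: PereiraSilva2025, §3.3 p.4 l.3–28] -/
theorem uniform_of_steps (K : Consts) (hL : Step33_LinearIneq K) (hσ : Step33_Sign K)
    (hI : Step32_Identity) (hc : Step32_Cont) (hG : Step33_Gronwall) : Step33_Uniform := by
  intro ν T u₀ u p hS t ht
  have hk : k1 K (En₀ (u 0)) - k2 K ν (En₀ (u 0)) < 0 := by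
    have := hσ ν hS.visc u₀ hS.data_smooth hS.data_divFree hS.data_decay
    rwa [← hS.initial] at this
  set k : ℝ := k1 K (En₀ (u 0)) - k2 K ν (En₀ (u 0)) with hkdef
  have hder : ∀ s ∈ Ioo 0 T, ∃ D : ℝ, HasDerivAt (Ens u) D s ∧ D ≤ k * Ens u s := by
    intro s hs
    have h2 := (hI ν T u₀ u p hS s hs).const_mul 2
    have hfun : Ens u = fun r => 2 * ((1 / 2) * Ens u r) := by
      funext r
      ring
    have hD : HasDerivAt (Ens u) (2 * (stretchP (u s) - ν * G u s)) s := by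
      rw [hfun]
      exact h2
    exact ⟨_, hD, hL ν T u₀ u p hS s hs _ hD⟩
  have hgr := hG T k (Ens u) (hc ν T u₀ u p hS) hder t ht
  have h0 : 0 ≤ Ens u 0 := integral_nonneg fun x => by positivity
  have hexp : Real.exp (k * t) ≤ 1 :=
    Real.exp_le_one_iff.2 (mul_nonpos_of_nonpos_of_nonneg hk.le ht.1)
  calc Ens u t ≤ Ens u 0 * Real.exp (k * t) := hgr
    _ ≤ Ens u 0 * 1 := mul_le_mul_of_nonneg_left hexp h0
    _ = Ens u 0 := mul_one _

/-- **CLAY LINK (PROVED): the uniform enstrophy bound IS Fefferman's (A)** — §3.4–§3.6 («`S` bounded ⇒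
no blow-up ⇒ `u, p ∈ C^∞(ℝ³ × [0,∞))`») is, in the kernel, the tree's enstrophy bridge
`clayR3_regularity_iff_aprioriEnstrophyBound` (Leray 1934 §20/§33, Constantin–Fefferman 1993).
[cite: PereiraSilva2025, §3.4–§3.6 p.4–5; §4 p.5 l.40] [cite: FeffermanClay2006, (A) p.2] -/
theorem clay_of_uniform (hU : Step33_Uniform) : clayR3.Regularity :=
  clayR3_regularity_iff_aprioriEnstrophyBound.2 fun μ hμ u₀ hs hdiv hdec T u p hsol h0 hE =>
    ⟨Ens u 0, fun t ht => hU μ T u₀ u p ⟨hμ, hs, hdiv, hdec, hsol, h0, hE⟩ t ht⟩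

/-- **§3.3 ⊢ §4 (PROVED)**: the uniform enstrophy bound gives the claimed statement — existence and
smoothness on the closed half-space through (A) (`clay_of_uniform`), uniqueness against every
finite-energy classical solution from the same datum by Tao's Cor. 11.4 (`eqOn_Ico_of_claySolution`).
[cite: PereiraSilva2025, §3.6 p.5 l.1–35; §4 p.5 l.37–41] [cite: Tao2011, Cor. 11.4] -/
theorem claim_of_uniform (hU : Step33_Uniform) : ClaimedTheorem := by
  intro ν hν u₀ hs hdiv hdec
  obtain ⟨u, p, hu, hp, hns, hE⟩ := clay_of_uniform hU ν hν u₀ hs hdiv hdec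
  have hcl := isNavierStokesSolution_and_smooth_iff.1 ⟨hns, hu, hp⟩
  refine ⟨u, p, hcl.1, hcl.2, hu, hp, fun T v q hv hv0 hvE t ht => ?_⟩
  exact (eqOn_Ico_of_claySolution hν (memLp_fderiv_two_of_rapidDecay hdec (hs.of_le (by norm_cast)))
    hcl.1 hcl.2 hE hv hv0 hvE t ht).symm

/-- **COMPOSITION (PROVED)** in the paper's own logic, every binder used: «Combining» (p.3 l.143–147),
the Poincaré use (l.165), the proviso (l.167) ⊢ `dS/dt ≤ (k₁ − k₂)S`; with the assumed sign
(l.251–252 / p.4 l.12), the differentiability and continuity of `S` and Grönwall ⊢ `S(t) ≤ S(0)` on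
every slab (§3.3) ⊢ the claim (§3.4–§4 = tree bridge + Tao uniqueness). The displays p.3 l.32–132
(Hölder, GN, GN′, C, §3.1, Young, stretching bound) are the printed derivation of «Combining» and are
recorded above, each decidable alone. [cite: PereiraSilva2025, §3.2–§4 p.3–5] -/
theorem claim_of_steps (K : Consts) (hC : Step32_Combine K) (hP : Step32_PoincareSol K)
    (hν : Step32_Proviso K) (hσ : Step33_Sign K) (hI : Step32_Identity) (hc : Step32_Cont)
    (hG : Step33_Gronwall) : ClaimedTheorem :=
  claim_of_uniform (uniform_of_steps K (linearIneq_of_steps K hC hP hν) hσ hI hc hG)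

/-- The same composition to Fefferman's (A). [cite: PereiraSilva2025, §3.2–§4 p.3–5] [cite: FeffermanClay2006, (A) p.2] -/
theorem clay_of_steps (K : Consts) (hC : Step32_Combine K) (hP : Step32_PoincareSol K)
    (hν : Step32_Proviso K) (hσ : Step33_Sign K) (hI : Step32_Identity) (hc : Step32_Cont)
    (hG : Step33_Gronwall) : clayR3.Regularity :=
  clay_of_uniform (uniform_of_steps K (linearIneq_of_steps K hC hP hν) hσ hI hc hG)

/-! ## Appendix (rev 2, APPEND-ONLY — every rev-1 declaration above is byte-identical): the `t = 0`
link from the solution-grain Poincaré binder to its §2 face, and kernel certificates for two TRUE steps -/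

/-- Every Clay datum launches a solution of the class on some slab `[0,T)`, `T > 0`: by the tree's
alternative `clayR3_solvable_or_supBlowup` either the Clay solution (restricted to `[0,1)`) or the
blow-up solution on its own slab. [cite: Leray1934, §33] [cite: Tao2011, Thm 5.4, Cor. 11.1, Cor. 11.4] -/
theorem exists_slabSol {ν : ℝ} (hν : 0 < ν) {u₀ : E3 → E3} (hs : ContDiff ℝ ∞ u₀)
    (hdiv : NSWave0.IsDivFree u₀) (hdec : HasRapidSpatialDecay u₀) :
    ∃ T : ℝ, 0 < T ∧ ∃ (u : ℝ → E3 → E3) (p : ℝ → E3 → ℝ), SlabSol ν T u₀ u p := by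
  rcases clayR3_solvable_or_supBlowup hν hs hdiv hdec with hsol | ⟨Ts, hTs, u, p, hcl, hu0, hE, -, -⟩
  · obtain ⟨u, p, hcl, hu0, C, hC, hb⟩ := clayR3_solvable_zero_iff_classical.mp hsol
    exact ⟨1, one_pos, u, p,
      ⟨hν, hs, hdiv, hdec, hcl.mono Ico_subset_Ici_self (uniqueDiffOn_Ico 0 1), hu0,
        C, hC, fun t ht => hb t ht.1⟩⟩
  · exact ⟨Ts, hTs, u, p, ⟨hν, hs, hdiv, hdec, hcl, hu0, hE⟩⟩

/-- **The §2 Poincaré face follows from its use along solutions (`t = 0` link, PROVED)**: if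
«`‖∇ω‖²_{L²} ≥ C_P S`» holds along every solution of the class (`Step32_PoincareSol K`, p.3 l.165), then
it holds for the vorticity of every Schwartz divergence-free field (`Step2_Poincare K`, p.2 l.29–34) —
evaluate at `t = 0` on a solution launched from the field (`exists_slabSol`). So a refutation of the §2
display PROPAGATES in the kernel to the binder `Step32_PoincareSol K` of `claim_of_steps`
(`not_poincareSol_of_not_poincare`). [cite: PereiraSilva2025, §2 p.2 l.29–34; p.3 l.165] -/
theorem poincare_of_poincareSol (K : Consts) (h : Step32_PoincareSol K) : Step2_Poincare K := by
  intro v hv hdiv hdec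
  obtain ⟨T, hT, u, p, hS⟩ := exists_slabSol one_pos hv hdiv hdec
  have h0 := h 1 T v u p hS 0 ⟨le_rfl, hT⟩
  simp only [Ens, G] at h0
  rw [hS.initial] at h0
  simpa only [l2sq] using h0

/-- Contrapositive of `poincare_of_poincareSol`, the refuter's handle: `¬ Step2_Poincare K` kills the
binder `Step32_PoincareSol K`. [cite: PereiraSilva2025, §2 p.2 l.29–34; p.3 l.165] -/
theorem not_poincareSol_of_not_poincare (K : Consts) (h : ¬ Step2_Poincare K) :
    ¬ Step32_PoincareSol K :=
  fun h' => h (poincare_of_poincareSol K h')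

/-- **Step 3.1 is TRUE (kernel certificate)**: `E(t) ≤ E(0)` on `[0,T)` along every solution of the class —
from the energy inequality of finite-energy classical solutions (tree, via C136's
`PaiLimsuwan2026.step1_Energy24_holds`: `‖u(t)‖² + 2ν∫₀ᵗ‖∇u‖² ≤ ‖u(0)‖²`).
[cite: PereiraSilva2025, §3.1 p.2 l.101–112] [cite: Leray1934, §17] -/
theorem step31_Energy_holds : Step31_Energy := by
  intro ν T u₀ u p hS t ht
  have h := PaiLimsuwan2026.step1_Energy24_holds ν T u₀ u p hS t ht
  have hint : 0 ≤ ∫ s in (0 : ℝ)..t, PaiLimsuwan2026.gradsq u s :=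
    intervalIntegral.integral_nonneg ht.1 fun s _ =>
      integral_nonneg fun x => by positivity
  have hν := hS.visc
  unfold PaiLimsuwan2026.energy at h
  unfold En₀
  nlinarith [h, hint, hν, mul_nonneg (mul_nonneg two_pos.le hν.le) hint]

/-- **Step 3.3-Grönwall is TRUE (kernel certificate)**, at the real grain at which it is typed: a function
continuous on `[0,T)`, differentiable on `(0,T)` with `S' ≤ kS` there, satisfies `S(t) ≤ S(0)e^{kt}` on
`[0,T)` (the product `S(t)e^{−kt}` is non-increasing: Mathlib `antitoneOn_of_deriv_nonpos`).
[cite: PereiraSilva2025, §3.3 p.4 l.12–14] [folklore] -/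
theorem step33_Gronwall_holds : Step33_Gronwall := by
  intro T k S hcont hder t ht
  have hT : 0 < T := ht.1.trans_lt ht.2
  set g : ℝ → ℝ := fun s => S s * Real.exp (-(k * s)) with hgdef
  have hg : ∀ s ∈ Ioo 0 T, ∃ D : ℝ,
      HasDerivAt g (D * Real.exp (-(k * s)) + S s * (Real.exp (-(k * s)) * -(k * 1))) s ∧
        D ≤ k * S s := fun s hs => by
    obtain ⟨D, hD, hle⟩ := hder s hs
    exact ⟨D, hD.mul (((hasDerivAt_id' s).const_mul k).neg.exp), hle⟩
  have hgc : ContinuousOn g (Ico 0 T) :=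
    hcont.mul (Continuous.continuousOn (by fun_prop))
  have hgd : DifferentiableOn ℝ g (interior (Ico 0 T)) := by
    rw [interior_Ico]
    intro s hs
    obtain ⟨D, hD, -⟩ := hg s hs
    exact hD.differentiableAt.differentiableWithinAt
  have hgd' : ∀ s ∈ interior (Ico 0 T), deriv g s ≤ 0 := by
    rw [interior_Ico]
    intro s hs
    obtain ⟨D, hD, hle⟩ := hg s hs
    rw [hD.deriv]
    have h1 := mul_le_mul_of_nonneg_left hle (Real.exp_pos (-(k * s))).le
    nlinarith [h1]
  have hanti := antitoneOn_of_deriv_nonpos (convex_Ico 0 T) hgc hgd hgd'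
  have hgt : g t ≤ g 0 := hanti ⟨le_rfl, hT⟩ ht ht.1
  have hg0 : g 0 = S 0 := by simp [hgdef]
  rw [hg0] at hgt
  have h2 := mul_le_mul_of_nonneg_right hgt (Real.exp_pos (k * t)).le
  have h3 : g t * Real.exp (k * t) = S t := by
    simp only [hgdef]
    rw [mul_assoc, ← Real.exp_add, neg_add_cancel, Real.exp_zero, mul_one]
  linarith [h2, h3]

/-! ## Appendix (rev 3, APPEND-ONLY — every rev-2 declaration above is byte-identical): the Hölder
display of §3.2 is TRUE — `Step32_Holder` discharged (D-0026 debt −1; no new named fact) -/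

/-- A rapidly decaying field has a bounded Jacobian. [folklore] -/
private theorem exists_bound_fderiv {v : E3 → E3} (hd : HasRapidSpatialDecay v) :
    ∃ C : ℝ, 0 ≤ C ∧ ∀ x, ‖fderiv ℝ v x‖ ≤ C := by
  obtain ⟨C, hC⟩ := hd 1 0
  refine ⟨max C 0, le_max_right _ _, fun x => ?_⟩
  have h := hC x
  rw [pow_zero, one_mul, norm_iteratedFDeriv_one] at h
  exact h.trans (le_max_left _ _)

/-- For a smooth rapidly decaying field, `‖Dv‖²` is integrable (tree: `Dv ∈ L²`). [folklore] -/
private theorem integrable_norm_fderiv_sq {v : E3 → E3} (hs : ContDiff ℝ ∞ v)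
    (hd : HasRapidSpatialDecay v) : Integrable (fun x => ‖fderiv ℝ v x‖ ^ 2) :=
  (memLp_fderiv_two_of_rapidDecay hd (hs.of_le (by exact_mod_cast le_top))).integrable_norm_pow
    two_ne_zero

/-- For a smooth rapidly decaying field, `‖Dv‖³` is integrable. [folklore] -/
private theorem integrable_norm_fderiv_cube {v : E3 → E3} (hs : ContDiff ℝ ∞ v)
    (hd : HasRapidSpatialDecay v) : Integrable (fun x => ‖fderiv ℝ v x‖ ^ 3) := by
  obtain ⟨C, hC0, hC⟩ := exists_bound_fderiv hd
  have h1 : ContDiff ℝ 1 v := hs.of_le (by exact_mod_cast le_top)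
  have hcont : Continuous fun x => fderiv ℝ v x := h1.continuous_fderiv one_ne_zero
  refine ((integrable_norm_fderiv_sq hs hd).const_mul C).mono' (by fun_prop)
    (Eventually.of_forall fun x => ?_)
  rw [Real.norm_of_nonneg (by positivity)]
  calc ‖fderiv ℝ v x‖ ^ 3 = ‖fderiv ℝ v x‖ * ‖fderiv ℝ v x‖ ^ 2 := by ring
    _ ≤ C * ‖fderiv ℝ v x‖ ^ 2 := by gcongr; exact hC x

/-- For a smooth rapidly decaying field, `‖curl v‖³` is integrable. [folklore] -/
private theorem integrable_norm_curl_cube {v : E3 → E3} (hs : ContDiff ℝ ∞ v)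
    (hd : HasRapidSpatialDecay v) : Integrable (fun x => ‖curl v x‖ ^ 3) := by
  obtain ⟨C, hC0, hC⟩ := exists_bound_fderiv hd
  have h1 : ContDiff ℝ 1 v := hs.of_le (by exact_mod_cast le_top)
  have hcont : Continuous fun x => fderiv ℝ v x := h1.continuous_fderiv one_ne_zero
  have hcurl : Continuous (curl v) := by
    rw [curl_eq_curlCLM_comp]; exact curlCLM.continuous.comp hcont
  refine ((integrable_norm_fderiv_sq hs hd).const_mul ((‖curlCLM‖ * C) * ‖curlCLM‖ ^ 2)).mono'
    (by fun_prop) (Eventually.of_forall fun x => ?_)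
  rw [Real.norm_of_nonneg (by positivity)]
  have hω : ‖curl v x‖ ≤ ‖curlCLM‖ * ‖fderiv ℝ v x‖ := norm_curl_le v x
  have hω' : ‖curl v x‖ ≤ ‖curlCLM‖ * C :=
    hω.trans (mul_le_mul_of_nonneg_left (hC x) (by positivity))
  have h2 : ‖curl v x‖ ^ 2 ≤ (‖curlCLM‖ * ‖fderiv ℝ v x‖) ^ 2 := by gcongr
  calc ‖curl v x‖ ^ 3 = ‖curl v x‖ * ‖curl v x‖ ^ 2 := by ring
    _ ≤ (‖curlCLM‖ * C) * (‖curlCLM‖ * ‖fderiv ℝ v x‖) ^ 2 := by gcongr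
    _ = (‖curlCLM‖ * C) * ‖curlCLM‖ ^ 2 * ‖fderiv ℝ v x‖ ^ 2 := by ring

/-- **Step 3.2-Hölder PROVED** (p.3 l.32–44): `|∫ω·((ω·∇)u)| ≤ ‖ω‖_{L³}‖ω‖_{L³}‖∇u‖_{L³}` — pointwise
`|⟪ω, Dv ω⟫| ≤ |ω|²‖Dv‖` and Hölder with exponents `3/2, 3`. [cite: PereiraSilva2025, p.3 l.32–44] -/
theorem step32_Holder_holds : Step32_Holder := by
  intro v hs hd
  have h1 : ContDiff ℝ 1 v := hs.of_le (by exact_mod_cast le_top)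
  have hcont : Continuous fun x => fderiv ℝ v x := h1.continuous_fderiv one_ne_zero
  have hcurl : Continuous (curl v) := by
    rw [curl_eq_curlCLM_comp]; exact curlCLM.continuous.comp hcont
  have hI3ω := integrable_norm_curl_cube hs hd
  have hI3D := integrable_norm_fderiv_cube hs hd
  -- the two Hölder factors
  set f : E3 → ℝ := fun x => ‖curl v x‖ ^ 2 with hf
  set g : E3 → ℝ := fun x => ‖fderiv ℝ v x‖ with hg
  have hf0 : ∀ x, 0 ≤ f x := fun x => by positivity
  have hg0 : ∀ x, 0 ≤ g x := fun x => norm_nonneg _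
  have hpq : (3 / 2 : ℝ).HolderConjugate 3 := by
    rw [Real.holderConjugate_iff]; norm_num
  -- `f ∈ L^{3/2}`, `g ∈ L³`
  have hfpow : ∀ x, f x ^ (3 / 2 : ℝ) = ‖curl v x‖ ^ 3 := fun x => by
    rw [hf]
    simp only
    rw [← Real.rpow_natCast _ 2, ← Real.rpow_mul (norm_nonneg _)]
    norm_num
  have hfL : MemLp f (ENNReal.ofReal (3 / 2)) volume := by
    have hmeas : AEStronglyMeasurable f volume := by
      have : Continuous f := by rw [hf]; fun_prop
      exact this.aestronglyMeasurable
    rw [← integrable_norm_rpow_iff hmeas (by simp) (by simp)]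
    rw [ENNReal.toReal_ofReal (by norm_num)]
    refine hI3ω.congr (Eventually.of_forall fun x => ?_)
    simp only
    rw [Real.norm_of_nonneg (hf0 x), hfpow]
  have hgL : MemLp g (ENNReal.ofReal 3) volume := by
    have hmeas : AEStronglyMeasurable g volume := by
      have : Continuous g := by rw [hg]; fun_prop
      exact this.aestronglyMeasurable
    rw [← integrable_norm_rpow_iff hmeas (by simp) (by simp)]
    rw [ENNReal.toReal_ofReal (by norm_num)]
    refine hI3D.congr (Eventually.of_forall fun x => ?_)
    simp only
    rw [hg, Real.norm_of_nonneg (norm_nonneg _)]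
    exact_mod_cast (Real.rpow_natCast ‖fderiv ℝ v x‖ 3).symm
  -- Hölder
  have hH := integral_mul_le_Lp_mul_Lq_of_nonneg hpq (Eventually.of_forall hf0)
    (Eventually.of_forall hg0) hfL hgL
  -- pointwise bound of the integrand
  have hpt : ∀ x, |inner ℝ (curl v x) (fderiv ℝ v x (curl v x))| ≤ f x * g x := fun x => by
    calc |inner ℝ (curl v x) (fderiv ℝ v x (curl v x))|
        ≤ ‖curl v x‖ * ‖fderiv ℝ v x (curl v x)‖ := abs_real_inner_le_norm _ _
      _ ≤ ‖curl v x‖ * (‖fderiv ℝ v x‖ * ‖curl v x‖) := by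
          gcongr; exact ContinuousLinearMap.le_opNorm _ _
      _ = f x * g x := by rw [hf, hg]; ring
  -- integrability of `f * g` (domination by `κ² C ‖Dv‖²`)
  obtain ⟨C, hC0, hC⟩ := exists_bound_fderiv hd
  have hfg : Integrable (fun x => f x * g x) := by
    refine ((integrable_norm_fderiv_sq hs hd).const_mul (‖curlCLM‖ ^ 2 * C)).mono'
      (by rw [hf, hg]; fun_prop) (Eventually.of_forall fun x => ?_)
    rw [Real.norm_of_nonneg (mul_nonneg (hf0 x) (hg0 x)), hf, hg]
    have h2 : ‖curl v x‖ ^ 2 ≤ (‖curlCLM‖ * ‖fderiv ℝ v x‖) ^ 2 := by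
      gcongr; exact norm_curl_le v x
    simp only
    calc ‖curl v x‖ ^ 2 * ‖fderiv ℝ v x‖
        ≤ (‖curlCLM‖ * ‖fderiv ℝ v x‖) ^ 2 * C := by gcongr; exact hC x
      _ = ‖curlCLM‖ ^ 2 * C * ‖fderiv ℝ v x‖ ^ 2 := by ring
  -- assembling
  have hA : ∫ x, f x ^ (3 / 2 : ℝ) = ∫ x, ‖curl v x‖ ^ 3 := integral_congr_ae (ae_of_all _ hfpow)
  have hB : ∫ x, g x ^ (3 : ℝ) = ∫ x, ‖fderiv ℝ v x‖ ^ 3 := by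
    refine integral_congr_ae (ae_of_all _ fun x => ?_)
    simp only [hg]
    exact_mod_cast Real.rpow_natCast ‖fderiv ℝ v x‖ 3
  have hnn : 0 ≤ ∫ x, ‖curl v x‖ ^ 3 := integral_nonneg fun x => by positivity
  calc |stretchP v| = |∫ x, inner ℝ (curl v x) (fderiv ℝ v x (curl v x))| := rfl
    _ ≤ ∫ x, |inner ℝ (curl v x) (fderiv ℝ v x (curl v x))| := abs_integral_le_integral_abs
    _ ≤ ∫ x, f x * g x :=
        integral_mono_of_nonneg (ae_of_all _ fun x => abs_nonneg _) hfg (ae_of_all _ hpt)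
    _ ≤ (∫ x, f x ^ (3 / 2 : ℝ)) ^ (1 / (3 / 2 : ℝ)) * (∫ x, g x ^ (3 : ℝ)) ^ (1 / (3 : ℝ)) := hH
    _ = l3 (curl v) * l3 (curl v) * gradL3 v := by
        rw [hA, hB]
        unfold l3 gradL3
        rw [show (1 / (3 / 2 : ℝ)) = 1 / 3 + 1 / 3 by norm_num,
          Real.rpow_add_of_nonneg hnn (by norm_num) (by norm_num)]

/-- `Step32_Holder` — `_holds` alias of `step32_Holder_holds` above under the fact's exact name (appended
2026-08-28, D-0026 bookkeeping: the proof term is the existing theorem of this file; no statement,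
definition or attribute is edited; no new named fact; the ledger's debt table listed the fact
unproved). [cite: PereiraSilva2025, p.3 l.32–44] -/
theorem _root_.Literature.Claims.NS.PereiraSilva2025.Step32_Holder_holds : Step32_Holder :=
  _root_.Literature.Claims.NS.PereiraSilva2025.step32_Holder_holds

end

end Literature.Claims.NS.PereiraSilva2025
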